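import Literature.NumberTheory.Transcendental.DiazMainIIISmallness
import Literature.NumberTheory.Transcendental.DiazMainIIIParams
import HarnessLib

/-!
# Laurent's Théorème 3 iii) — no common zero of the family in the ball, eventually

Topic `Literature/NumberTheory/Transcendental`. Fifth step of the conditional proof of the large
range of `Diaz1989_main_iii` (`DiazMain.lean`; M. Laurent, Astérisque 198–200 (1991), §3.1,
Théorème 3 iii); Diaz 1989 / Philippon 1986, Thm 2.12 (i)) from `Philippon1986_mainCriterion` and
`Philippon1986_GaGm`, after `DiazMainIIISmallness.lean` (`exists_aeval_Qj_ne_zero`, the zero lemma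
with multiplicities at a point of the ball) and `DiazMainIIIParams.lean` (the parameters and the
counting inequalities): the hypotheses of `exists_aeval_Qj_ne_zero` hold on the whole ball
`max|θ'_v - θ_v| ≤ e^{-ρ(X)}` for all large `X` — the analogue of `DiazZeroFreeBall.lean` for the
multiplicity case (the bookkeeping is ours). Everything is PROVED.

* `Emax`, `KV`, `Delta3` — the constants `E_max = ∑e^{|yᵢx_k|}`, `K_V = (3/2)E_max + n + m`
  (closeness `e^{-V} = K_Vε_b`) and `Δ = ∑(|yᵢx_k| + 1) + π(∑|yᵢ| + ∑|x_k| + 1)` (sizes).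
* `ball_hyps` — on the ball (`ε_bE_max ≤ 1/2`): `θ'(w_ik) ≠ 0`, and the closeness / size sums of
  the zero lemma for the logarithms `zlog3` and the coordinates `ytil`, `xtil`.
* `hmeas_of_measures` — the measure hypothesis of the zero lemma from a measure of linear
  independence of `y` (exponent `η`, height `L`) and a linear measure of `x` (height `LB²Δ`),
  under `C_yL^η + C_xLB²Δ + log(L²B²ΔK_V) < ρ`; `eventually_dom3` — this domination holds
  eventually (`m ≥ 2`, `ηm/n < 1 + m/n + m`, since `ρ = 4X^{1+m/n+m} log X`).
* `zeroFree_of_bounds`, **`eventually_zeroFree3`** — there is `c` (the constant of the zero lemma)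
  such that for all large `X`, all unknowns `p`, every `θ'` in the ball and every minimal index `j`
  at `θ'`, some `Q_{l,t,j}` with `l ≤ M₂ = (n+1)B`, `t ≤ T₂ = (n+1)T` does not vanish at `θ'`.

## References

* M. Laurent, *Sur quelques résultats récents de transcendance*, Astérisque 198–200 (1991),
  §3.1, Théorème 3 iii), p. 213. [Laurent1991]
* G. Diaz, *Grands degrés de transcendance pour des familles d'exponentielles*, J. Number Theory
  31 (1989), 1–23, §II-4-4, pp. 17–19 (the model, without multiplicities). [Diaz1989]
* P. Philippon, *Lemmes de zéros dans les groupes algébriques commutatifs*, Bull. Soc. Math.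
  France 114 (1986), 355–383. [Philippon1986]
-/

noncomputable section

open MvPolynomial Finset Finsupp Complex Filter Real
open Literature.NumberTheory.Transcendental.ExpGrid
open Literature.NumberTheory.Transcendental.Asymp
open Literature.NumberTheory.Transcendental.DiazThm1 (scale_zero_eq_exp)

namespace Literature.NumberTheory.Transcendental

namespace DiazMainIII

variable {n : ℕ}

/-! ### Constants attached to `(y, x)` -/

section Constants

variable {m' : ℕ}

/-- `E_max = ∑_{i,k} e^{|yᵢx_k|}`. [folklore] -/
def Emax (y : Fin n → ℂ) (x : Fin (m' + 1) → ℂ) : ℝ := ∑ i, ∑ k, Real.exp ‖y i * x k‖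

/-- `K_V = (3/2)E_max + n + m`: on the ball of radius `ε_b` the data of the zero lemma are
`K_Vε_b`-close to the true ones. [folklore] -/
def KV (y : Fin n → ℂ) (x : Fin (m' + 1) → ℂ) : ℝ := 3 / 2 * Emax y x + n + (m' + 1)

/-- `Δ = ∑_{i,k}(|yᵢx_k| + 1) + π(∑|yᵢ| + ∑|x_k| + 1)` (the size bound of the zero lemma). [folklore] -/
def Delta3 (y : Fin n → ℂ) (x : Fin (m' + 1) → ℂ) : ℝ :=
  ∑ i, ∑ k, (‖y i * x k‖ + 1) + Real.pi * (∑ i, ‖y i‖ + ∑ k, ‖x k‖ + 1)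

/-- `E_max ≥ 0`. [folklore] -/
theorem Emax_nonneg (y : Fin n → ℂ) (x : Fin (m' + 1) → ℂ) : 0 ≤ Emax y x := by
  unfold Emax; positivity

/-- `K_V ≥ 1`. [folklore] -/
theorem one_le_KV (y : Fin n → ℂ) (x : Fin (m' + 1) → ℂ) : 1 ≤ KV y x := by
  unfold KV; have := Emax_nonneg y x; have : (0 : ℝ) ≤ n := Nat.cast_nonneg n
  have : (0 : ℝ) ≤ m' := Nat.cast_nonneg m'; linarith

/-- `Δ ≥ π`. [folklore] -/
theorem pi_le_Delta3 (y : Fin n → ℂ) (x : Fin (m' + 1) → ℂ) : Real.pi ≤ Delta3 y x := by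
  unfold Delta3
  have h1 : 0 ≤ ∑ i, ∑ k, (‖y i * x k‖ + 1) := Finset.sum_nonneg fun _ _ => Finset.sum_nonneg fun _ _ => by positivity
  have h2 : 0 ≤ ∑ i, ‖y i‖ := Finset.sum_nonneg fun _ _ => norm_nonneg _
  have h3 : 0 ≤ ∑ k, ‖x k‖ := Finset.sum_nonneg fun _ _ => norm_nonneg _
  nlinarith [Real.pi_pos]

end Constants

/-! ### The hypotheses of the zero lemma on the ball -/

section Ball

variable {m' : ℕ} (y : Fin n → ℂ) (x : Fin (m' + 1) → ℂ)

/-- On the ball `max|θ'_v - θ_v| ≤ ε_b` with `ε_b E_max ≤ 1/2`: `θ'(w_ik) ≠ 0`, the logarithms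
`z_ik` are `(3/2)ε_be^{|yᵢx_k|}`-close to `yᵢx_k`, and the three closeness sums and the size sum of
the zero lemma hold with `e^{-V} = K_Vε_b`, `Δ = Delta3`. [folklore] -/
theorem ball_hyps {εb : ℝ} (hεb0 : 0 ≤ εb) (hsmall : εb * Emax y x ≤ 1 / 2)
    {θ' : Var n (m' + 1) → ℂ} (hball : ∀ v, ‖θ' v - pt y x v‖ ≤ εb) :
    (∀ i k, θ' (Sum.inr (Sum.inr (i, k))) ≠ 0) ∧
    (∑ i, ∑ k, ‖zlog3 y x θ' i k - y i * x k‖) ≤ KV y x * εb ∧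
    (∑ k, ‖xtil θ' k - x k‖) ≤ KV y x * εb ∧
    (∑ i, ‖ytil θ' i - y i‖) ≤ KV y x * εb ∧
    (∑ i, ∑ k, ‖zlog3 y x θ' i k‖) ≤ Delta3 y x := by
  have hE : ∀ i k, Real.exp ‖y i * x k‖ ≤ Emax y x := fun i k => by
    unfold Emax
    calc Real.exp ‖y i * x k‖ ≤ ∑ k', Real.exp ‖y i * x k'‖ :=
          Finset.single_le_sum (f := fun k' => Real.exp ‖y i * x k'‖) (fun _ _ => by positivity)
            (Finset.mem_univ k)
      _ ≤ ∑ i', ∑ k', Real.exp ‖y i' * x k'‖ :=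
          Finset.single_le_sum (f := fun i' => ∑ k', Real.exp ‖y i' * x k'‖)
            (fun _ _ => Finset.sum_nonneg fun _ _ => by positivity) (Finset.mem_univ i)
  have hw : ∀ i k, ‖θ' (Sum.inr (Sum.inr (i, k))) - cexp (y i * x k)‖ ≤ εb := fun i k =>
    hball (Sum.inr (Sum.inr (i, k)))
  have hexp : ∀ i k, ‖cexp (-(y i * x k))‖ ≤ Real.exp ‖y i * x k‖ := fun i k => by
    rw [Complex.norm_exp]
    exact Real.exp_le_exp.mpr ((Complex.re_le_norm _).trans (by rw [norm_neg]))
  have hprod : ∀ i k, ‖θ' (Sum.inr (Sum.inr (i, k))) - cexp (y i * x k)‖ * ‖cexp (-(y i * x k))‖ ≤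
      εb * Real.exp ‖y i * x k‖ := fun i k =>
    mul_le_mul (hw i k) (hexp i k) (norm_nonneg _) hεb0
  have hhalf : ∀ i k, εb * Real.exp ‖y i * x k‖ ≤ 1 / 2 := fun i k =>
    (mul_le_mul_of_nonneg_left (hE i k) hεb0).trans hsmall
  -- (1) non-vanishing
  have hne : ∀ i k, θ' (Sum.inr (Sum.inr (i, k))) ≠ 0 := by
    intro i k h0
    have h1 := hprod i k
    rw [h0, zero_sub, norm_neg, ← norm_mul, ← Complex.exp_add, add_neg_cancel, Complex.exp_zero,
      norm_one] at h1
    linarith [hhalf i k]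
  -- (2) the logarithms
  have hz : ∀ i k, ‖zlog3 y x θ' i k - y i * x k‖ ≤ 3 / 2 * (εb * Real.exp ‖y i * x k‖) := fun i k =>
    (norm_zlog3_sub_le y x i k ((hprod i k).trans (hhalf i k))).trans (by linarith [hprod i k])
  have hKV : KV y x = 3 / 2 * Emax y x + n + (m' + 1) := rfl
  have hE0 := Emax_nonneg y x
  refine ⟨hne, ?_, ?_, ?_, ?_⟩
  · calc ∑ i, ∑ k, ‖zlog3 y x θ' i k - y i * x k‖ ≤ ∑ i, ∑ k, 3 / 2 * (εb * Real.exp ‖y i * x k‖) :=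
          Finset.sum_le_sum fun i _ => Finset.sum_le_sum fun k _ => hz i k
      _ = 3 / 2 * Emax y x * εb := by
          unfold Emax; rw [Finset.mul_sum, Finset.sum_mul]
          refine Finset.sum_congr rfl fun i _ => ?_
          rw [Finset.mul_sum, Finset.sum_mul]
          refine Finset.sum_congr rfl fun k _ => ?_; ring
      _ ≤ KV y x * εb := by
          rw [hKV]; refine mul_le_mul_of_nonneg_right ?_ hεb0
          have : (0 : ℝ) ≤ n := Nat.cast_nonneg n
          have : (0 : ℝ) ≤ m' := Nat.cast_nonneg m'
          linarith
  · calc ∑ k, ‖xtil θ' k - x k‖ ≤ ∑ _k : Fin (m' + 1), εb :=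
          Finset.sum_le_sum fun k _ => hball (Sum.inr (Sum.inl k))
      _ = ((m' : ℝ) + 1) * εb := by simp
      _ ≤ KV y x * εb := by
          rw [hKV]; refine mul_le_mul_of_nonneg_right ?_ hεb0
          have : (0 : ℝ) ≤ n := Nat.cast_nonneg n
          linarith
  · calc ∑ i, ‖ytil θ' i - y i‖ ≤ ∑ _i : Fin n, εb := Finset.sum_le_sum fun i _ => hball (Sum.inl i)
      _ = (n : ℝ) * εb := by simp
      _ ≤ KV y x * εb := by
          rw [hKV]; refine mul_le_mul_of_nonneg_right ?_ hεb0
          have : (0 : ℝ) ≤ m' := Nat.cast_nonneg m'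
          linarith
  · unfold Delta3
    have h1 : ∑ i, ∑ k, ‖zlog3 y x θ' i k‖ ≤ ∑ i, ∑ k, (‖y i * x k‖ + 1) := by
      refine Finset.sum_le_sum fun i _ => Finset.sum_le_sum fun k _ => ?_
      have := norm_le_norm_add_norm_sub' (zlog3 y x θ' i k) (y i * x k)
      have := hz i k
      have := hhalf i k
      linarith
    have h2 : 0 ≤ Real.pi * (∑ i, ‖y i‖ + ∑ k, ‖x k‖ + 1) := by
      have : 0 ≤ ∑ i, ‖y i‖ := Finset.sum_nonneg fun _ _ => norm_nonneg _
      have : 0 ≤ ∑ k, ‖x k‖ := Finset.sum_nonneg fun _ _ => norm_nonneg _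
      positivity
    linarith

end Ball


/-! ### No common zero in the ball, eventually -/

section ZeroFree

variable {m' : ℕ}

/-- **The measure hypothesis of the zero lemma from the two measures of linear independence.**
If `|∑λ_hy_h| ≥ e^{-C_yL^η}` for `0 < max|λ_h| ≤ L` and `|∑μ_kx_k| ≥ e^{-C_xH}` for
`0 < max|μ_k| ≤ H = LB²Δ`, and `C_yL^η + C_x LB²Δ + log(L²B²Δ K) < ρ`, then
`L²B²Δ·(Ke^{-ρ}) < |∑λ_hy_h|·|∑μ_kx_k|`. [folklore] -/
theorem hmeas_of_measures (y : Fin n → ℂ) (x : Fin (m' + 1) → ℂ) {η Cy Cx : ℝ}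
    (hy : ∀ h : Fin n → ℤ, h ≠ 0 → ∀ H : ℝ, (∀ i, (|h i| : ℝ) ≤ H) →
      Real.exp (-(Cy * H ^ η)) ≤ ‖∑ i, (h i : ℂ) * y i‖)
    (hx : ∀ h : Fin (m' + 1) → ℤ, h ≠ 0 → ∀ H : ℝ, (∀ i, (|h i| : ℝ) ≤ H) →
      Real.exp (-(Cx * H ^ (1 : ℝ))) ≤ ‖∑ i, (h i : ℂ) * x i‖)
    {L B : ℕ} {Δ K ρ : ℝ} (hL : 1 ≤ L) (hB : 1 ≤ B) (hΔ : 0 < Δ) (hK : 0 < K)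
    (hdom : Cy * (L : ℝ) ^ η + Cx * ((L : ℝ) * B ^ 2 * Δ) + Real.log ((L : ℝ) ^ 2 * B ^ 2 * Δ * K) < ρ)
    (lam : Fin n → ℤ) (mu : Fin (m' + 1) → ℤ) (hlam : lam ≠ 0) (hmu : mu ≠ 0)
    (hlamL : ∀ h, |lam h| ≤ (L : ℤ)) (hmuL : ∀ k, (|mu k| : ℝ) ≤ L * B ^ 2 * Δ) :
    (L : ℝ) ^ 2 * B ^ 2 * Δ * (K * Real.exp (-ρ)) < ‖∑ h, (lam h : ℂ) * y h‖ * ‖∑ k, (mu k : ℂ) * x k‖ := by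
  have h1 := hy lam hlam L (fun i => by exact_mod_cast hlamL i)
  have h2 := hx mu hmu ((L : ℝ) * B ^ 2 * Δ) hmuL
  rw [Real.rpow_one] at h2
  have hpos : 0 < (L : ℝ) ^ 2 * B ^ 2 * Δ * K := by positivity
  calc (L : ℝ) ^ 2 * B ^ 2 * Δ * (K * Real.exp (-ρ))
      = Real.exp (Real.log ((L : ℝ) ^ 2 * B ^ 2 * Δ * K) - ρ) := by
        rw [Real.exp_sub, Real.exp_log hpos, Real.exp_neg]; ring
    _ < Real.exp (-(Cy * (L : ℝ) ^ η)) * Real.exp (-(Cx * ((L : ℝ) * B ^ 2 * Δ))) := by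
        rw [← Real.exp_add]; exact Real.exp_lt_exp.mpr (by linarith)
    _ ≤ ‖∑ h, (lam h : ℂ) * y h‖ * ‖∑ k, (mu k : ℂ) * x k‖ :=
        mul_le_mul h1 h2 (Real.exp_pos _).le (norm_nonneg _)

/-- **No common zero of the family in the ball, from numerical bounds at level `X`** (the zero lemma
with multiplicities `exists_aeval_Qj_ne_zero` at a point `θ'` of the ball `max|θ'_v - θ_v| ≤ e^{-ρ}`):
given the constant `c` of the zero lemma, if at level `X` the parameters satisfy `B, D, L ≥ 1`, the
two counting inequalities, `e^{-ρ}E_max ≤ 1/2`, and the domination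
`C_yL^η + C_xLB²Δ + log(L²B²ΔK_V) < ρ`, then at every minimal index `j` some member `Q_{l,t,j}`,
`l ≤ M₂ = (n+1)B`, `t ≤ T₂ = (n+1)T`, does not vanish at `θ'`.
[cite: Diaz1989, §II-4-4, pp. 17–19 (the model, without multiplicities)] -/
theorem zeroFree_of_bounds (hn : 1 ≤ n) (y : Fin n → ℂ) (x : Fin (m' + 1) → ℂ) {η Cy Cx : ℝ}
    (hy : ∀ h : Fin n → ℤ, h ≠ 0 → ∀ H : ℝ, (∀ i, (|h i| : ℝ) ≤ H) →
      Real.exp (-(Cy * H ^ η)) ≤ ‖∑ i, (h i : ℂ) * y i‖)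
    (hx : ∀ h : Fin (m' + 1) → ℤ, h ≠ 0 → ∀ H : ℝ, (∀ i, (|h i| : ℝ) ≤ H) →
      Real.exp (-(Cx * H ^ (1 : ℝ))) ≤ ‖∑ i, (h i : ℂ) * x i‖)
    {c : ℕ} (hc : ∀ (m : ℕ) (hm : 1 ≤ m) (D L b B T : ℕ) (p : Unk n m D L b → ℤ) (y : Fin n → ℂ)
      (x : Fin m → ℂ) (θ' : Var n m → ℂ) (j : Var n m →₀ ℕ) (V Δ : ℝ),
      1 ≤ B → 1 ≤ D → 1 ≤ L → Real.pi ≤ Δ →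
      IsMinIdx p θ' j →
      (∀ i k, θ' (Sum.inr (Sum.inr (i, k))) ≠ 0) →
      (∑ i, ∑ k, ‖zlog3 y x θ' i k - y i * x k‖) ≤ Real.exp (-V) →
      (∑ k, ‖xtil θ' k - x k‖) ≤ Real.exp (-V) →
      (∑ i, ‖ytil θ' i - y i‖) ≤ Real.exp (-V) →
      (∑ i, ∑ k, ‖zlog3 y x θ' i k‖) ≤ Δ → Real.pi * ‖y ⟨0, hn⟩‖ ≤ Δ →
      Real.pi * ‖x ⟨0, hm⟩‖ ≤ Δ →
      c * D * L ^ n < (T + 1) * (B + 1) ^ m →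
      c * L ^ n < (T + 1) * (B + 1) ^ (m - 1) →
      (∀ (lam : Fin n → ℤ) (mu : Fin m → ℤ), lam ≠ 0 → mu ≠ 0 →
        (∀ h, |lam h| ≤ (L : ℤ)) → (∀ k, (|mu k| : ℝ) ≤ L * B ^ 2 * Δ) →
        (L : ℝ) ^ 2 * B ^ 2 * Δ * Real.exp (-V) <
          ‖∑ h, (lam h : ℂ) * y h‖ * ‖∑ k, (mu k : ℂ) * x k‖) →
      ∃ (l : Fin m → ℕ) (t : ℕ), (∀ k, l k ≤ (n + 1) * B) ∧ t < (n + 1) * T + 1 ∧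
        aeval θ' (Qj p l t j) ≠ 0)
    {X : ℝ} (hB1 : 1 ≤ Bq n (m' + 1) c X) (hD1 : 1 ≤ Dq n (m' + 1) X) (hL1 : 1 ≤ Lq n (m' + 1) X)
    (hcount₁ : c * Dq n (m' + 1) X * Lq n (m' + 1) X ^ n <
      (Tq n (m' + 1) X + 1) * (Bq n (m' + 1) c X + 1) ^ (m' + 1))
    (hcount₂ : c * Lq n (m' + 1) X ^ n < (Tq n (m' + 1) X + 1) * (Bq n (m' + 1) c X + 1) ^ (m' + 1 - 1))
    (hsmall : Real.exp (-rho3 n (m' + 1) X) * Emax y x ≤ 1 / 2)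
    (hdom : Cy * (Lq n (m' + 1) X : ℝ) ^ η +
        Cx * ((Lq n (m' + 1) X : ℝ) * (Bq n (m' + 1) c X : ℝ) ^ 2 * Delta3 y x) +
        Real.log ((Lq n (m' + 1) X : ℝ) ^ 2 * (Bq n (m' + 1) c X : ℝ) ^ 2 * Delta3 y x * KV y x) <
      rho3 n (m' + 1) X)
    (p : Unk n (m' + 1) (Dq n (m' + 1) X) (Lq n (m' + 1) X) (bq n (m' + 1) X) → ℤ)
    {θ' : Var n (m' + 1) → ℂ} (hball : ∀ v, ‖θ' v - pt y x v‖ ≤ Real.exp (-rho3 n (m' + 1) X))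
    {j : Var n (m' + 1) →₀ ℕ} (hj : IsMinIdx p θ' j) :
    ∃ (l : Fin (m' + 1) → ℕ) (t : ℕ), (∀ k, l k ≤ M2q n (m' + 1) c X) ∧ t ≤ T2q n (m' + 1) X ∧
      aeval θ' (Qj p l t j) ≠ 0 := by
  set εb : ℝ := Real.exp (-rho3 n (m' + 1) X) with hεb
  have hεb0 : 0 < εb := Real.exp_pos _
  obtain ⟨hne, hz, hxt, hyt, hzΔ⟩ := ball_hyps y x hεb0.le hsmall hball
  have hKV0 : 0 < KV y x := lt_of_lt_of_le one_pos (one_le_KV y x)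
  -- `e^{-V} = K_V ε_b`
  set V : ℝ := -Real.log (KV y x * εb) with hV
  have hexpV : Real.exp (-V) = KV y x * εb := by
    rw [hV, neg_neg, Real.exp_log (by positivity)]
  have hΔπ := pi_le_Delta3 y x
  have hΔ0 : 0 < Delta3 y x := lt_of_lt_of_le Real.pi_pos hΔπ
  -- the size hypotheses
  have hyΔ : Real.pi * ‖y ⟨0, hn⟩‖ ≤ Delta3 y x := by
    unfold Delta3
    have h1 : ‖y ⟨0, hn⟩‖ ≤ ∑ i, ‖y i‖ :=
      Finset.single_le_sum (f := fun i => ‖y i‖) (fun _ _ => norm_nonneg _) (Finset.mem_univ _)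
    have h2 : 0 ≤ ∑ k, ‖x k‖ := Finset.sum_nonneg fun _ _ => norm_nonneg _
    have h3 : 0 ≤ ∑ i, ∑ k, (‖y i * x k‖ + 1) :=
      Finset.sum_nonneg fun _ _ => Finset.sum_nonneg fun _ _ => by positivity
    nlinarith [Real.pi_pos]
  have hxΔ : Real.pi * ‖x ⟨0, Nat.succ_pos m'⟩‖ ≤ Delta3 y x := by
    unfold Delta3
    have h1 : ‖x ⟨0, Nat.succ_pos m'⟩‖ ≤ ∑ k, ‖x k‖ :=
      Finset.single_le_sum (f := fun k => ‖x k‖) (fun _ _ => norm_nonneg _) (Finset.mem_univ _)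
    have h2 : 0 ≤ ∑ i, ‖y i‖ := Finset.sum_nonneg fun _ _ => norm_nonneg _
    have h3 : 0 ≤ ∑ i, ∑ k, (‖y i * x k‖ + 1) :=
      Finset.sum_nonneg fun _ _ => Finset.sum_nonneg fun _ _ => by positivity
    nlinarith [Real.pi_pos]
  -- the measure hypothesis
  have hmeas : ∀ (lam : Fin n → ℤ) (mu : Fin (m' + 1) → ℤ), lam ≠ 0 → mu ≠ 0 →
      (∀ h, |lam h| ≤ (Lq n (m' + 1) X : ℤ)) →
      (∀ k, (|mu k| : ℝ) ≤ Lq n (m' + 1) X * (Bq n (m' + 1) c X : ℝ) ^ 2 * Delta3 y x) →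
      (Lq n (m' + 1) X : ℝ) ^ 2 * (Bq n (m' + 1) c X : ℝ) ^ 2 * Delta3 y x * Real.exp (-V) <
        ‖∑ h, (lam h : ℂ) * y h‖ * ‖∑ k, (mu k : ℂ) * x k‖ := by
    intro lam mu hlam hmu hlamL hmuL
    rw [hexpV, hεb]
    exact hmeas_of_measures y x hy hx hL1 hB1 hΔ0 hKV0 hdom lam mu hlam hmu hlamL hmuL
  obtain ⟨l, t, hl, ht, hQ⟩ := hc (m' + 1) (Nat.succ_pos m') (Dq n (m' + 1) X) (Lq n (m' + 1) X)
    (bq n (m' + 1) X) (Bq n (m' + 1) c X) (Tq n (m' + 1) X) p y x θ' j V (Delta3 y x) hB1 hD1 hL1 hΔπ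
    hj hne (by rw [hexpV]; exact hz) (by rw [hexpV]; exact hxt) (by rw [hexpV]; exact hyt) hzΔ hyΔ hxΔ
    hcount₁ hcount₂ hmeas
  refine ⟨l, t, fun k => ?_, ?_, hQ⟩
  · unfold M2q; exact hl k
  · unfold T2q; omega


/-- **The domination `C_yL^η + C_xLB²Δ + log(L²B²ΔK) < ρ = 4Ψ`, eventually** (`m = m'+1 ≥ 2`,
`ηm/n < 1 + m/n + m`). [folklore] -/
theorem eventually_dom3 (hn : 1 ≤ n) (hm' : 1 ≤ m') {η : ℝ} (hη : 0 ≤ η)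
    (hηb : η * (((m' + 1 : ℕ) : ℝ) / n) < 1 + ((m' + 1 : ℕ) : ℝ) / n + (m' + 1 : ℕ))
    (Cy Cx Δ K : ℝ) (hΔ : 0 < Δ) (hK : 1 ≤ K) (c : ℕ) :
    ∀ᶠ X in atTop, Cy * (Lq n (m' + 1) X : ℝ) ^ η +
        Cx * ((Lq n (m' + 1) X : ℝ) * (Bq n (m' + 1) c X : ℝ) ^ 2 * Δ) +
        Real.log ((Lq n (m' + 1) X : ℝ) ^ 2 * (Bq n (m' + 1) c X : ℝ) ^ 2 * Δ * K) <
      rho3 n (m' + 1) X := by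
  set m : ℕ := m' + 1 with hm
  have hm1 : 1 ≤ m := by omega
  have hmn : (0 : ℝ) < (m : ℝ) / n := by
    have : (0 : ℝ) < n := by exact_mod_cast hn
    have : (0 : ℝ) < m := by exact_mod_cast hm1
    positivity
  have hm'r : (1 : ℝ) ≤ m' := by exact_mod_cast hm'
  have hm2 : (2 : ℝ) ≤ m := by rw [hm]; push_cast; linarith
  have hK0 : 0 < K := by linarith
  have hpow : (0 : ℝ) < 1 + (m : ℝ) / n + m := by positivity
  -- the three dominations
  have h1 := eventually_mul_scale_le_of_lt (a := η * ((m : ℝ) / n)) (a' := 1 + (m : ℝ) / n + m)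
    hηb 0 1 |Cy|
  have h2 := eventually_mul_scale_le_of_lt (a := 2 + (m : ℝ) / n) (a' := 1 + (m : ℝ) / n + m)
    (by linarith) 0 1 (|Cx| * (aB n m c : ℝ) ^ 2 * Δ)
  have h3 := eventually_mul_scale_le_of_lt (a := (1 : ℝ)) (a' := 1 + (m : ℝ) / n + m)
    (by linarith) 0 1 (|Real.log ((aB n m c : ℝ) ^ 2 * Δ * K)| + (2 + 2 * ((m : ℝ) / n)))
  filter_upwards [h1, h2, h3, eventually_gt_atTop (1 : ℝ), eventually_M_ge,
    eventually_L_ge (n := n) (m := m) hn hm1] with X h1X h2X h3X hX1 hM hL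
  have hX0 : 0 < X := by linarith
  have hΨ : 0 < Psi3 n m X := scale_pos hX1
  have hρ : rho3 n m X = 4 * Psi3 n m X := rfl
  have hLle : (Lq n m X : ℝ) ≤ scale ((m : ℝ) / n) 0 X := L_le hX1.le
  have hL1 : (1 : ℝ) ≤ Lq n m X := by exact_mod_cast (show 1 ≤ Lq n m X from le_trans (by norm_num) hL.2)
  have hMle : (Mq X : ℝ) ≤ X := M_le hX0.le
  have haB1 : (1 : ℝ) ≤ aB n m c := by exact_mod_cast one_le_aB (n := n) (m := m) (c := c)
  have hB : (Bq n m c X : ℝ) = aB n m c * Mq X := by unfold Bq; push_cast; ring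
  have hB1 : (1 : ℝ) ≤ Bq n m c X := by
    rw [hB]; have : (2 : ℝ) ≤ Mq X := by exact_mod_cast hM.2
    nlinarith
  have hBle : (Bq n m c X : ℝ) ≤ aB n m c * X := by rw [hB]; exact mul_le_mul_of_nonneg_left hMle (by positivity)
  -- (1) `Cy L^η ≤ |Cy| X^{ηm/n} ≤ Ψ`
  have t1 : Cy * (Lq n m X : ℝ) ^ η ≤ Psi3 n m X := by
    have hLη : (Lq n m X : ℝ) ^ η ≤ scale (η * ((m : ℝ) / n)) 0 X := by
      calc (Lq n m X : ℝ) ^ η ≤ (scale ((m : ℝ) / n) 0 X) ^ η :=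
            Real.rpow_le_rpow (Nat.cast_nonneg _) hLle hη
        _ = scale ((m : ℝ) / n * η) (0 * η) X := scale_rpow hX1.le
        _ = scale (η * ((m : ℝ) / n)) 0 X := by rw [zero_mul, mul_comm]
    have hLη0 : 0 ≤ (Lq n m X : ℝ) ^ η := Real.rpow_nonneg (Nat.cast_nonneg _) η
    calc Cy * (Lq n m X : ℝ) ^ η ≤ |Cy| * (Lq n m X : ℝ) ^ η :=
          mul_le_mul_of_nonneg_right (le_abs_self _) hLη0
      _ ≤ |Cy| * scale (η * ((m : ℝ) / n)) 0 X := mul_le_mul_of_nonneg_left hLη (abs_nonneg _)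
      _ ≤ Psi3 n m X := h1X
  -- (2) `Cx L B² Δ ≤ |Cx| a_B² Δ X^{2+m/n} ≤ Ψ`
  have t2 : Cx * ((Lq n m X : ℝ) * (Bq n m c X : ℝ) ^ 2 * Δ) ≤ Psi3 n m X := by
    have hsc : scale ((m : ℝ) / n) 0 X * X ^ 2 = scale (2 + (m : ℝ) / n) 0 X := by
      have : X ^ 2 = scale 2 0 X := by
        rw [scale, Real.rpow_zero, mul_one]; exact_mod_cast (Real.rpow_natCast X 2).symm
      rw [this, scale_mul_scale hX1]; ring_nf
    have hs0 : 0 ≤ scale ((m : ℝ) / n) 0 X := scale_nonneg hX1.le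
    have hLBΔ : (Lq n m X : ℝ) * (Bq n m c X : ℝ) ^ 2 * Δ ≤ (aB n m c : ℝ) ^ 2 * Δ * scale (2 + (m : ℝ) / n) 0 X := by
      calc (Lq n m X : ℝ) * (Bq n m c X : ℝ) ^ 2 * Δ ≤ scale ((m : ℝ) / n) 0 X * (aB n m c * X) ^ 2 * Δ := by
            gcongr
        _ = (aB n m c : ℝ) ^ 2 * Δ * (scale ((m : ℝ) / n) 0 X * X ^ 2) := by ring
        _ = _ := by rw [hsc]
    have h0 : 0 ≤ (Lq n m X : ℝ) * (Bq n m c X : ℝ) ^ 2 * Δ := by positivity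
    calc Cx * ((Lq n m X : ℝ) * (Bq n m c X : ℝ) ^ 2 * Δ) ≤ |Cx| * ((Lq n m X : ℝ) * (Bq n m c X : ℝ) ^ 2 * Δ) :=
          mul_le_mul_of_nonneg_right (le_abs_self _) h0
      _ ≤ |Cx| * ((aB n m c : ℝ) ^ 2 * Δ * scale (2 + (m : ℝ) / n) 0 X) :=
          mul_le_mul_of_nonneg_left hLBΔ (abs_nonneg _)
      _ = |Cx| * (aB n m c : ℝ) ^ 2 * Δ * scale (2 + (m : ℝ) / n) 0 X := by ring
      _ ≤ Psi3 n m X := h2X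
  -- (3) `log(L²B²ΔK) ≤ log(a_B²ΔK) + (2 + 2m/n) log X ≤ (…) X ≤ Ψ`
  have t3 : Real.log ((Lq n m X : ℝ) ^ 2 * (Bq n m c X : ℝ) ^ 2 * Δ * K) ≤ Psi3 n m X := by
    have hlogX : 0 < Real.log X := Real.log_pos hX1
    have hlogXle : Real.log X ≤ X := (Real.log_le_sub_one_of_pos hX0).trans (by linarith)
    have hprod : (Lq n m X : ℝ) ^ 2 * (Bq n m c X : ℝ) ^ 2 * Δ * K ≤
        ((aB n m c : ℝ) ^ 2 * Δ * K) * (scale ((m : ℝ) / n) 0 X ^ 2 * X ^ 2) := by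
      have hs0 : 0 ≤ scale ((m : ℝ) / n) 0 X := scale_nonneg hX1.le
      calc (Lq n m X : ℝ) ^ 2 * (Bq n m c X : ℝ) ^ 2 * Δ * K
          ≤ scale ((m : ℝ) / n) 0 X ^ 2 * (aB n m c * X) ^ 2 * Δ * K := by gcongr
        _ = _ := by ring
    have hpos : 0 < (Lq n m X : ℝ) ^ 2 * (Bq n m c X : ℝ) ^ 2 * Δ * K := by positivity
    have hs : scale ((m : ℝ) / n) 0 X ^ 2 * X ^ 2 = Real.exp ((2 + 2 * ((m : ℝ) / n)) * Real.log X) := by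
      rw [scale_zero_eq_exp _ hX0, ← Real.exp_nat_mul]
      conv_lhs => rw [show X ^ 2 = Real.exp (2 * Real.log X) by
        rw [← Real.exp_log hX0, ← Real.exp_nat_mul, Real.log_exp]; norm_num]
      rw [← Real.exp_add]; congr 1; push_cast; ring
    calc Real.log ((Lq n m X : ℝ) ^ 2 * (Bq n m c X : ℝ) ^ 2 * Δ * K)
        ≤ Real.log (((aB n m c : ℝ) ^ 2 * Δ * K) * (scale ((m : ℝ) / n) 0 X ^ 2 * X ^ 2)) :=
          Real.log_le_log hpos hprod
      _ = Real.log ((aB n m c : ℝ) ^ 2 * Δ * K) + (2 + 2 * ((m : ℝ) / n)) * Real.log X := by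
          rw [Real.log_mul (by positivity) (mul_ne_zero (pow_ne_zero _ (scale_pos hX1).ne') (pow_ne_zero _ hX0.ne')),
            hs, Real.log_exp]
      _ ≤ |Real.log ((aB n m c : ℝ) ^ 2 * Δ * K)| * X + (2 + 2 * ((m : ℝ) / n)) * X := by
          have ha : Real.log ((aB n m c : ℝ) ^ 2 * Δ * K) ≤ |Real.log ((aB n m c : ℝ) ^ 2 * Δ * K)| * X := by
            calc Real.log ((aB n m c : ℝ) ^ 2 * Δ * K) ≤ |Real.log ((aB n m c : ℝ) ^ 2 * Δ * K)| := le_abs_self _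
              _ = |Real.log ((aB n m c : ℝ) ^ 2 * Δ * K)| * 1 := (mul_one _).symm
              _ ≤ _ := mul_le_mul_of_nonneg_left hX1.le (abs_nonneg _)
          have hb : (2 + 2 * ((m : ℝ) / n)) * Real.log X ≤ (2 + 2 * ((m : ℝ) / n)) * X :=
            mul_le_mul_of_nonneg_left hlogXle (by positivity)
          linarith
      _ = (|Real.log ((aB n m c : ℝ) ^ 2 * Δ * K)| + (2 + 2 * ((m : ℝ) / n))) * scale 1 0 X := by
          rw [scale_one_zero]; ring
      _ ≤ Psi3 n m X := h3X
  rw [hρ]; linarith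

/-- **No common zero of the family in the ball, eventually.** For `n ≥ 1` frequencies `y` with a
measure of linear independence of exponent `η ≥ 0`, `ηm/n < 1 + m/n + m`, and `m = m'+1 ≥ 2`
points `x` with a linear measure, there is a constant `c` (that of the zero lemma with
multiplicities) such that for all large `X`, for all unknowns `p`, every point `θ'` of the ball
`max|θ'_v - θ_v| ≤ e^{-ρ(X)}` and every minimal index `j` at `θ'`, some `Q_{l,t,j}` with
`l ≤ M₂`, `t ≤ T₂` does not vanish at `θ'`.
[cite: Diaz1989, §II-4-4, pp. 17–19 (the model, without multiplicities)] -/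
theorem eventually_zeroFree3 (hZ : Philippon1986_GaGm) (hn : 1 ≤ n) (hm' : 1 ≤ m')
    (y : Fin n → ℂ) (x : Fin (m' + 1) → ℂ) {η Cy Cx : ℝ} (hη : 0 ≤ η)
    (hηb : η * (((m' + 1 : ℕ) : ℝ) / n) < 1 + ((m' + 1 : ℕ) : ℝ) / n + (m' + 1 : ℕ))
    (hy : ∀ h : Fin n → ℤ, h ≠ 0 → ∀ H : ℝ, (∀ i, (|h i| : ℝ) ≤ H) →
      Real.exp (-(Cy * H ^ η)) ≤ ‖∑ i, (h i : ℂ) * y i‖)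
    (hx : ∀ h : Fin (m' + 1) → ℤ, h ≠ 0 → ∀ H : ℝ, (∀ i, (|h i| : ℝ) ≤ H) →
      Real.exp (-(Cx * H ^ (1 : ℝ))) ≤ ‖∑ i, (h i : ℂ) * x i‖) :
    ∃ c : ℕ, ∀ᶠ X in atTop,
      ∀ (p : Unk n (m' + 1) (Dq n (m' + 1) X) (Lq n (m' + 1) X) (bq n (m' + 1) X) → ℤ)
        (θ' : Var n (m' + 1) → ℂ), (∀ v, ‖θ' v - pt y x v‖ ≤ Real.exp (-rho3 n (m' + 1) X)) →
        ∀ j : Var n (m' + 1) →₀ ℕ, IsMinIdx p θ' j →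
          ∃ (l : Fin (m' + 1) → ℕ) (t : ℕ), (∀ k, l k ≤ M2q n (m' + 1) c X) ∧
            t ≤ T2q n (m' + 1) X ∧ aeval θ' (Qj p l t j) ≠ 0 := by
  obtain ⟨c, hc⟩ := exists_aeval_Qj_ne_zero hZ n hn
  refine ⟨c, ?_⟩
  have hm1 : 1 ≤ m' + 1 := by omega
  have hpow : (0 : ℝ) < 1 + (((m' + 1 : ℕ) : ℝ)) / n + (m' + 1 : ℕ) := by positivity
  have hsm := eventually_const_le_scale (a := 1 + (((m' + 1 : ℕ) : ℝ)) / n + (m' + 1 : ℕ)) (b := 1)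
    (Or.inl hpow) (Real.log (2 * Emax y x + 1))
  filter_upwards [eventually_M_ge, eventually_L_ge (n := n) (m := m' + 1) hn hm1,
    eventually_counting₁ (n := n) (m := m' + 1) c hn hm1, eventually_counting₂ (n := n) (m := m' + 1) c hn hm1,
    eventually_dom3 (n := n) hn hm' hη hηb Cy Cx (Delta3 y x) (KV y x)
      (lt_of_lt_of_le Real.pi_pos (pi_le_Delta3 y x)) (one_le_KV y x) c, hsm]
    with X hM hL hc1 hc2 hdom hsmX p θ' hball j hj
  have hL1 : 1 ≤ Lq n (m' + 1) X := le_trans (by norm_num) hL.2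
  have hB1 : 1 ≤ Bq n (m' + 1) c X := by
    unfold Bq; exact le_trans (by norm_num) (Nat.mul_le_mul one_le_aB hM.2)
  have hD1 : 1 ≤ Dq n (m' + 1) X := by
    unfold Dq Sq
    exact le_trans (by norm_num) (Nat.mul_le_mul one_le_aD (Nat.mul_le_mul hL.2 hM.2))
  have hsmall : Real.exp (-rho3 n (m' + 1) X) * Emax y x ≤ 1 / 2 := by
    have hE := Emax_nonneg y x
    have hΨ : Real.log (2 * Emax y x + 1) ≤ Psi3 n (m' + 1) X := hsmX
    have hρ : rho3 n (m' + 1) X = 4 * Psi3 n (m' + 1) X := rfl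
    have h1 : Real.exp (-rho3 n (m' + 1) X) ≤ 1 / (2 * Emax y x + 1) := by
      have hpos : 0 < 2 * Emax y x + 1 := by positivity
      have : 0 ≤ Real.log (2 * Emax y x + 1) := Real.log_nonneg (by linarith)
      calc Real.exp (-rho3 n (m' + 1) X) ≤ Real.exp (-Real.log (2 * Emax y x + 1)) :=
            Real.exp_le_exp.mpr (by rw [hρ]; linarith)
        _ = 1 / (2 * Emax y x + 1) := by rw [Real.exp_neg, Real.exp_log hpos, one_div]
    calc Real.exp (-rho3 n (m' + 1) X) * Emax y x ≤ 1 / (2 * Emax y x + 1) * Emax y x :=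
          mul_le_mul_of_nonneg_right h1 hE
      _ ≤ 1 / 2 := by
          rw [div_mul_eq_mul_div, one_mul, div_le_iff₀ (by positivity)]; linarith
  exact zeroFree_of_bounds hn y x hy hx hc hB1 hD1 hL1 hc1 hc2 hsmall hdom p hball hj

end ZeroFree

end DiazMainIII

end Literature.NumberTheory.Transcendental

end
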